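import Summits.BirchSwinnertonDyer.BirchSwinnertonDyer.Theorems.PrintCf2RubinValueTwoCClassUpsilonAdditiveDoor
import Summits.BirchSwinnertonDyer.BirchSwinnertonDyer.Theorems.PrintCf2SplitBadTwoAdditiveAtSeven
import Literature.NumberTheory.EllipticCurves.ComplexMultiplicationBurungaleFlachCorOneProofs
import HarnessLib

/-!
# [T3]-input, part 4′: the door «`E′/K` additive at some `w ∤ 2`» CLOSED BY NAME — `w = (√-7)`, `j(E′) = -3375`

Cell `bsd-print-cf2`, width seat `bsd-line-cf2-p1-w3` g19 (supplying the one displayed class fact of -w8 g6's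
`…CClassUpsilonAdditiveDoor`, p732237); class item `MainConjClauseAtSplitTwoQuadDAClass` (route C rev 23,
`stmt-BirchSwinnertonDyer-23300`), step (0) of cf2c-w2 g8's (Q)-class RECIPE.  `--supports` 23300 (helper); Theses-free;
THEOREMS ONLY; 0 facts / 0 defs / 0 sorry.

The door of part 4 is `∃ w, 2 ∉ w ∧ (W′.baseChange K).HasAdditiveReductionAt w` for the class's good twist `W′/ℚ` with
`W′.j ∈ maximalCMJInvariants`, `IsCMFieldOfJ K W′.j`, `d_K = -7`.  It is a tree theorem: `IsCMFieldOfJ.discr_eq`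
(`d_K = cmFieldDiscr j`) and the nine-row table force `j(W′) = -3375`; LEAD g11's
`AdditiveAtSeven.hasAdditiveReductionAt_baseChange_of_j_eq_cm7_of_finrank_eq_two` (`ord_w Δ = e·(6a+3) ∉ 12ℤ` at every
`w ∣ 7` of every quadratic `K`, Silverman VII.5.1(c)) gives additive reduction at the place above `7`, which does not
contain `2`.

* `j_eq_neg_3375_of_isCMFieldOfJ_of_discr_eq_neg_seven` — `j ∈ maximalCMJInvariants`, `IsCMFieldOfJ K j`, `d_K = -7` ⟹ `j = -3375`;
* ★ `exists_hasAdditiveReductionAt_baseChange_of_isCMFieldOfJ_of_discr_eq_neg_seven` — the door VERBATIM;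
* ★★ `exists_mem_pairKer_mul_mem_qDivisionFieldSubgroup_two_of_deuring_of_seven` — part 4's
  `…_of_deuring_of_hasAdditiveReductionAt` with the door discharged: **step (0) is hypothesis-free modulo the Deuring
  split print** (`∀ h, ∃ τ ∈ pairKer κ₁ κ₂, h * τ ∈ (W′.baseChange K).qDivisionFieldSubgroup 2`).

HONEST FRAMING: closes nothing by itself; no summit statement is proved by this seat; BSD is not proved by any of this.

## References
* [SilvermanAEC2009] J. H. Silverman, *The Arithmetic of Elliptic Curves* (2009), VII.5 Prop. 5.1(c), X.5 Prop. 5.4.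
* [SilvermanATAEC1994] J. H. Silverman, *Advanced Topics* (1994), App. A §3 (row `D = -7`).
* [Rubin1999] K. Rubin, LNM 1716 (1999), §5 Prop. 5.4, (7).
-/

-- the summit namespace `Summit.BirchSwinnertonDyer.BirchSwinnertonDyer` repeats the problem name by design (D-0017)
set_option linter.dupNamespace false
set_option autoImplicit false

noncomputable section

open scoped Classical

open Field NumberField IsDedekindDomain WeierstrassCurve Literature.NumberTheory.EllipticCurves
  Literature.NumberTheory.GaloisRepresentations
open Summit.BirchSwinnertonDyer.BirchSwinnertonDyer.Theorems.PrintCf2.AdditiveAtSeven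

namespace Summit.BirchSwinnertonDyer.BirchSwinnertonDyer.Theorems.PrintCf2.UpsilonSurjects

variable {K : Type} [Field K] [NumberField K]

/-- **`j ∈ maximalCMJInvariants` with CM field `K` of discriminant `-7` forces `j = -3375`** (the row `D = -7` of
Silverman's table: `d_K = cmFieldDiscr j` by `IsCMFieldOfJ.discr_eq`, and `cmFieldDiscr j = -7` only for `j = -3375`).
[cite: SilvermanATAEC1994, App. A §3 (row D = -7)] -/
theorem j_eq_neg_3375_of_isCMFieldOfJ_of_discr_eq_neg_seven {j : ℚ} (hj : j ∈ maximalCMJInvariants)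
    (hK : IsCMFieldOfJ K j) (hdK : NumberField.discr K = -7) : j = -3375 := by
  have h := IsCMFieldOfJ.discr_eq hj hK
  rw [hdK] at h
  simp only [maximalCMJInvariants, Finset.mem_insert, Finset.mem_singleton] at hj
  rcases hj with rfl | rfl | rfl | rfl | rfl | rfl | rfl | rfl | rfl <;> first | rfl | norm_num [cmFieldDiscr] at h

/-- ★ **The door of part 4, BY NAME: a CM curve `W/ℚ` with `W.j ∈ maximalCMJInvariants` and CM field `K`,
`d_K = -7`, `[K:ℚ] = 2`, has ADDITIVE reduction over `K` at some place not above `2`** — the place above `7`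
(`j(W) = -3375`; LEAD g11's `hasAdditiveReductionAt_baseChange_of_j_eq_cm7_of_finrank_eq_two`: `ord_w Δ = e(6a+3) ∉ 12ℤ`).
[cite: SilvermanAEC2009, X.5 Prop. 5.4 with VII.5 Prop. 5.1(c)] [cite: SilvermanATAEC1994, App. A §3 (row D = -7)] -/
theorem exists_hasAdditiveReductionAt_baseChange_of_isCMFieldOfJ_of_discr_eq_neg_seven
    (hK2 : Module.finrank ℚ K = 2) (hdK : NumberField.discr K = -7)
    (W : WeierstrassCurve ℚ) [W.IsElliptic] (hj : W.j ∈ maximalCMJInvariants) (hK : IsCMFieldOfJ K W.j) :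
    ∃ w : HeightOneSpectrum (𝓞 K), ((2 : ℕ) : 𝓞 K) ∉ w.asIdeal ∧ (W.baseChange K).HasAdditiveReductionAt w := by
  have hjW : W.j = -3375 := j_eq_neg_3375_of_isCMFieldOfJ_of_discr_eq_neg_seven hj hK hdK
  obtain ⟨w, h7⟩ := AdditiveAtSeven.exists_heightOneSpectrum_natCast_mem (K := K) (by norm_num : (7 : ℕ).Prime)
  exact ⟨w, natCast_two_notMem_of_seven_mem w h7,
    hasAdditiveReductionAt_baseChange_of_j_eq_cm7_of_finrank_eq_two K w hK2 W hjW h7⟩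

/-- ★★ **[T3]-input, step (0) of the (Q)-class recipe, with NO displayed class fact**: `W′/ℚ` with CM by `𝓞_K`
(`K` imaginary quadratic, `d_K = -7`), Deuring frame `(c, ψ′)`, `2 = v·v̄`, the Deuring split print, a generator pair
`(κ; γ)` with `κ₁` unramified outside `v`, `κ₂` outside `v̄` ⟹
`∀ h ∈ Γ_K, ∃ τ ∈ pairKer κ₁ κ₂, h * τ ∈ (W′.baseChange K).qDivisionFieldSubgroup 2` — -w8 g6's
`…_of_deuring_of_hasAdditiveReductionAt` with its door `hadd` supplied by
`exists_hasAdditiveReductionAt_baseChange_of_isCMFieldOfJ_of_discr_eq_neg_seven`.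
[cite: Rubin1999, §5 Prop. 5.4, Cor. 5.5, (7)] [cite: SilvermanAEC2009, III.8.1, VII.7.1, X.5 Prop. 5.4] -/
theorem exists_mem_pairKer_mul_mem_qDivisionFieldSubgroup_two_of_deuring_of_seven
    (hDG : Deuring_galoisAction_cmPrimaryTorsion_split)
    (W : WeierstrassCurve ℚ) [W.IsElliptic] [W.IsGloballyMinimal] (hj : W.j ∈ maximalCMJInvariants)
    (K : Type) [Field K] [NumberField K] (hKq : IsImaginaryQuadratic K) (hdK : NumberField.discr K = -7)
    (hK : IsCMFieldOfJ K W.j) (c : K ≃ₐ[ℚ] K) (hc : c ≠ 1)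
    (ψ : HeckeCharacter K) (hψ : ψ.HasInfinityType (fun _ ↦ 1) (fun _ ↦ 0)) (hψc : IsHeckeConjEquivariant c ψ)
    (hL : ∀ s : ℂ, 3 / 2 < s.re → heckeLFunction ψ s = W.LSeries s)
    (v vbar : HeightOneSpectrum (𝓞 K))
    (hv : ((2 : ℕ) : 𝓞 K) ∈ v.asIdeal) (hvbar : ((2 : ℕ) : 𝓞 K) ∈ vbar.asIdeal) (hne : vbar ≠ v)
    {κ₁ κ₂ : ZpExtension K 2} {γ₁ γ₂ : absoluteGaloisGroup K} (hγ : ZpExtension.IsTopGeneratorPair κ₁ κ₂ γ₁ γ₂)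
    (hκ₁ : κ₁.IsUnramifiedOutside v) (hκ₂ : κ₂.IsUnramifiedOutside vbar)
    (h : absoluteGaloisGroup K) :
    ∃ τ ∈ ZpExtension.pairKer κ₁ κ₂, h * τ ∈ (W.baseChange K).qDivisionFieldSubgroup 2 :=
  exists_mem_pairKer_mul_mem_qDivisionFieldSubgroup_two_of_deuring_of_hasAdditiveReductionAt hDG W hj K hKq hdK hK c
    hc ψ hψ hψc hL v vbar hv hvbar hne hγ hκ₁ hκ₂
    (exists_hasAdditiveReductionAt_baseChange_of_isCMFieldOfJ_of_discr_eq_neg_seven hKq.1 hdK W hj hK) h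

end Summit.BirchSwinnertonDyer.BirchSwinnertonDyer.Theorems.PrintCf2.UpsilonSurjects

end
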